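import Literature.AnabelianGeometry.EtaleTheta.Discharge.Sec5OfThetaSetting
import Literature.AnabelianGeometry.EtaleTheta.Discharge.Sec5SgpUniqueAtGenuineBases

/-!
# [EtTh] §5 p. 331: F-0554 `SgpUnique` («the homomorphisms `s^⊓-gp_N`, `s^⊔-gp_N` are uniquely determined by these relations») AT THE §5 DATA
# OF THE SETTING (`ofThetaSettingData` over `mkOfThetaSettingYdd`), NO hypothesis beyond the data

S. Mochizuki, *The étale theta function and its Frobenioid-theoretic manifestations*, Publ. RIMS **45** (2009), §5 p. 331 (PDF p. 105)
[cite: MochizukiEtTh2009, §5 p.331 (PDF p.105)].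

abc-iut cell, D-0079 ORIGINAL-L / L-F [EtTh] (FACT row F-0554 `ThetaFrobenioid.SgpUnique`; node `EtTh:§5-data`), seat abc-iut-w6-d053 (gen 5), sequel of
`Sec5SectionLawsAtThetaSettingYdd.lean` (p462478) for the census `LF-ETTH-S5B.tsv`.  PROOF-ONLY (0 definitions, no instance, no new `Prop`):
abc-iut-L2-t4's generic `sgpUnique_ofConnectedTemperoidData` (`Discharge/Sec5SgpUniqueAtGenuineBases.lean`, total epimorphicity of the model
Frobenioid) read AT THE SETTING'S OWN §5 DATA through `ofThetaSettingData_eq` (`rfl`) and the abbrev `mkOfThetaSettingYdd`.  Nothing landed is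
edited or restated.
HONEST FRAMING: kernel re-keying at the junction; `tf` is an abstract parameter; nothing here bears on [IUTchIII] Cor. 3.12; no side taken;
typed ≠ proved.
-/

noncomputable section

namespace Literature.AnabelianGeometry.EtaleTheta

open CategoryTheory Opposite Literature.AlgebraicGeometry.Frobenioids Literature.AnabelianGeometry.SemiGraphs

universe v₀

namespace ThetaFrobenioid

variable {p : ℕ} [Fact p.Prime] {D : ThetaSetting p} {E : D.EtaleThetaData} {l : ℕ} {C : E.DoubleUnderline l}
  {e : D.toTemperedCurve.GroupLevelData} {N : ℕ+} (μ : D.CyclotomeMod l N) (hC : D.Compat) (hS : D.Sec2Hyps)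
  {D₀ : Type} [Category.{v₀} D₀] {V : FrdIMonoidStub.{0}} {T₀ : RealifiedDivisorMonoids (D₀ := D₀) V}
  {VD : FrdICatStub.{1, 0, 0} (ConnectedPart (BTemp (C.temperedArithmeticGroup e).Pi))}
  {tf : TemperedFrobenioid T₀ (ConnectedPart (BTemp (C.temperedArithmeticGroup e).Pi)) VD} {hZ : tf.monoidType = MonoidType.Z}
  {hP : ∀ A : (ConnectedPart (BTemp (C.temperedArithmeticGroup e).Pi))ᵒᵖ, IsPerfect (tf.Φ.carrier A)}
  {NH : Subgroup (Field.absoluteGaloisGroup D.K) → tf.category → ℕ+ → Prop}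
  {pullFrac : ∀ {A A' : (BiKummerSetting.mkOfThetaSettingYdd C e μ hC hS tf hZ hP NH).C} (_ : A' ⟶ A),
    (BiKummerSetting.mkOfThetaSettingYdd C e μ hC hS tf hZ hP NH).biratUnits A →
      (BiKummerSetting.mkOfThetaSettingYdd C e μ hC hS tf hZ hP NH).biratUnits A'}
  {θ : (BiKummerSetting.mkOfThetaSettingYdd C e μ hC hS tf hZ hP NH).biratUnits (BiKummerSetting.mkOfThetaSettingYdd C e μ hC hS tf hZ hP NH).Aodot}
  {Bl : (BiKummerSetting.mkOfThetaSettingYdd C e μ hC hS tf hZ hP NH).C}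
  {Pl : (BiKummerSetting.mkOfThetaSettingYdd C e μ hC hS tf hZ hP NH).FractionPair θ Bl}
  {Rl : (BiKummerSetting.mkOfThetaSettingYdd C e μ hC hS tf hZ hP NH).NthRoot θ Pl C.lPNat pullFrac}
  (h : ModelFrobenioid.Hypotheses tf.divisorMonoid tf.ratFnFunctor)
  (Q : FrobenioidTheta.ThetaSubquotientStub.{0} (ConnectedPart (BTemp (C.temperedArithmeticGroup e).Pi)))
  (R : (BiKummerSetting.mkOfThetaSettingYdd C e μ hC hS tf hZ hP NH).NthRoot Rl.root Rl.pair N pullFrac)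
  (K' : Type) [Field K'] (constEmb : K'ˣ →* tf.biratUnitsModel R.BN) (constEmb_injective : Function.Injective constEmb)
  (hinvc : ∀ g : Aut R.AN.base,
    pull tf.divisorMonoid g.hom (ModelFrobenioid.div R.pair.num) = ModelFrobenioid.div R.pair.num)
  (hinvp : ∀ y : (C.thetaEnvData μ hC hS).PiX, y ∈ (C.thetaEnvData μ hC hS).PiYdd →
    pull tf.divisorMonoid ((BiKummerSetting.mkOfThetaSettingYdd C e μ hC hS tf hZ hP NH).galoisSurj
      R.AN.base R.αData.isGalois ((ContinuousMulEquiv.refl _) y)).hom (ModelFrobenioid.div R.pair.den) = ModelFrobenioid.div R.pair.den)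

/-- **F-0554 `SgpUnique` at the §5 data of the Setting (`A_⊙^bs := Ÿ̲̲`), NO hypothesis beyond the data.** [cite: MochizukiEtTh2009, §5 p.331 (PDF p.105)] -/
theorem sgpUnique_ofThetaSettingYddData :
    (ofThetaSettingData μ hC hS h Q R K' constEmb constEmb_injective hinvc hinvp).SgpUnique :=
  sgpUnique_ofConnectedTemperoidData (T := C.thetaEnvData μ hC hS) h Q C.odd_lPNat R (ContinuousMulEquiv.refl _) K' constEmb
    constEmb_injective hinvc hinvp

/-- **The p. 331 sentence in full at the §5 data of the Setting, NO hypothesis beyond the data**: the two defining relations HOLD (F-0552, F-0553)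
AND the homomorphisms satisfying them are unique (F-0554). [cite: MochizukiEtTh2009, §5 p.331 (PDF p.105)] -/
theorem sgpSpec_and_unique_ofThetaSettingYddData :
    (ofThetaSettingData μ hC hS h Q R K' constEmb constEmb_injective hinvc hinvp).SgpCapSpec ∧ (ofThetaSettingData μ hC hS h Q R K' constEmb constEmb_injective hinvc hinvp).SgpCupSpec ∧
      (ofThetaSettingData μ hC hS h Q R K' constEmb constEmb_injective hinvc hinvp).SgpUnique :=
  ⟨sgpCapSpec_ofConnectedTemperoidData (T := C.thetaEnvData μ hC hS) h Q C.odd_lPNat R (ContinuousMulEquiv.refl _) K' constEmb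
      constEmb_injective hinvc hinvp,
    sgpCupSpec_ofConnectedTemperoidData (T := C.thetaEnvData μ hC hS) h Q C.odd_lPNat R (ContinuousMulEquiv.refl _) K' constEmb
      constEmb_injective hinvc hinvp,
    sgpUnique_ofThetaSettingYddData μ hC hS h Q R K' constEmb constEmb_injective hinvc hinvp⟩

end ThetaFrobenioid

end Literature.AnabelianGeometry.EtaleTheta

end

-- tree-health (abc-iut-w6-d081 g5, 2026-08-26T21:00Z): comment-only re-land of a SKIPPED ACCEPT (accepted 19:06–19:14Z; serial farm import probe at 20:3xZ answers rc 75 «remote:stale:unbuilt» while the lane builds p90 < 2 min; dag tick #13 «> 60 min»);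
-- declarations byte-identical to the accepted version; purpose = trigger the rebuild. No content change.
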